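import Summits.QuantumFields.BalabanUV.Beta.GAN24.SrecBornSector
import Summits.QuantumFields.BalabanUV.Beta.GAN24.ContactKernelCells
import Summits.QuantumFields.BalabanUV.Beta.GAN24.StencilSlotLamRoot
import Summits.QuantumFields.BalabanUV.Beta.GAN24.FibreStrip

/-!
# `BalabanUV.Beta.GAN24.BornLambdaLineage` — binder row G-an2-4 / (CONV-C), CT-ROUTE, the row owner's `gen19/BORNSEC-PLAN-v0.md` (V8) «assembly CT-3cV»
# [leaf-01 or owner], PART 1 (the Λ-born sector, INSTANCE side): **THE REMAINDER SPLITS BY SECTOR, AND ITS Λ-BORN PART IN THE ADOPTED UNITS IS A SUM OVER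
# BIRTH LEVELS OF WEIGHTED THREE-LEG PUSHES OF EXPLICIT Λ-PIECES THROUGH THE DRESSED LEG CHAINS FROM THE BIRTH LEVEL — each lineage = the UNDRESSED one-shot
# push + a contact term whose three leg differences are ONE displayed pure-gauge family**

NOT IN PRINT; OUR BOOKKEEPING (G-an2-4 formalisation swarm → CRUX TEAM (2), leaf prover `b2b-balaban-gan24-formalise-leaf-01`, gen 59; «MINE» on (V8), journal
`CLAIMS.log` l.32877; leaf-03-g52's precision (P2) l.32842 adopted; names PROVISIONAL — the owner may rename / re-cut).  [folklore] bookkeeping over tree theorems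
BY NAME: leaf-03's (E-α-V) `SrecBornSector` (`bornSecAt_eq_sum_transport`, `unitS_bornSecAt_eq_sum`, `transport_unitStepMap_succ_eq_push₃`, the class lemmas),
leaf-01's `AffineUnroll.transport_add`, asym1's `HessKerDressedUnits.unitS`, an2's `InterLevelTransport.SLam` ∕ `locStencil_SLam`, an1's `hessFFAt`, the row owner's
`StencilSlotLamRoot.unitS_lamPiece_eq` ∕ `locStencil_unitS_lamPiece`, road P1's `FibreStrip.unitDecayK_holds`, and leaf-01 g58's
`ContactKernelCells.legChain_respStepBmSeq_sub_respStep` (the pure-gauge family of the dressed chain against the undressed one-shot response).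
0 `def`, 0 cited facts, 0 `def … : Prop`, 0 sorry.  HONEST FRAMING (cell contract, verbatim): «discharging `BetaPertH` makes Bałaban's UV stability
UNCONDITIONAL — a real constructive-QFT result; it is NOT the continuum limit and NOT the Clay problem.»  HONEST DEPENDENCY (verbatim): «continuum YM on T⁴ ⇐
BetaPertH ∧ nine spine estimates (0/9 proved); BetaPertH ⇐ (D1) ∧ (D4) ∧ CAP+tail; G-an2-4 gates asym, D1 and NE2/3/4.»

## What (generic `d`; in-block root `ρ = toSite rr`, `rr ∈ box (d+1) Lc`, where stated)
* §1 SECTOR SPLIT.  `freshAt_add` (the sources are the V-source `freshAt Lc ρ cVH 0` plus the Λ-source `freshAt Lc ρ 0 cΛ`), **`bornSecAt_add_sectors`**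
  (`bornSecAt Lc ρ cE cVH cΛ k = bornSecAt Lc ρ cE cVH 0 k + bornSecAt Lc ρ cE 0 cΛ k`: the decoupled affine recursion is additive in its sources on leaf-03's class),
  and the target's split **`exists_hB_of_sectors`**: `hB(cVH, cΛ) ⟸ hB(cVH, 0) ∧ hB(0, cΛ)` (one constant, the common rate).
* §2 THE Λ-SOURCE IN UNITS: `freshAt_lam_zero ∕ _succ`, **`unitS_freshAt_lam_zero ∕ _succ`** (member `j+1` in its own units is the Λ-piece of the UNIT-NORMALISED step
  resolvents with the `j`-FREE weight `cΛ·Lc^{2(d+1)}` — the row owner's `StencilSlotLamRoot.unitS_lamPiece_eq` BY NAME); `isFF_SLam_hessFFAt`, `isFF_freshAt_lam`, class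
  membership; and the letter (V7) IN `LocStencil` FORM: **`exists_hX_lam_of_unitDecayK`** (generic `d`, conditional on road P1's `UnitDecayK`: the owner's
  `locStencil_unitS_lamPiece` + member `0` `exists_locStencil_lamPiece_zero`) and **`exists_hX_lam_three`** (`d = 3`, UNCONDITIONAL by `FibreStrip.unitDecayK_holds`).
* §3 **`unitS_bornSecAt_eq_sum_range`** (leaf-03's closed form re-indexed over the birth levels `i ∈ range (k+1)`: `Σ_i transport unitStepMap i (k−i) (unitS_i (freshAt i))`)
  and **`unitS_bornLam_eq_sum_push₃`**: `unitS_k (bornSecAt Lc ρ cE 0 cΛ k) = unitS_k (freshAt Lc ρ 0 cΛ k) + Σ_{i<k} (cE·Lc^{2(d+1)})^{k−i} • push₃ T_i T_i T_i (unitS_i (freshAt Lc ρ 0 cΛ i))`,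
  `T_i = legChain (respStepBmSeq ρ Lc) i (k−1−i)` — the Λ-piece is ff-valued, so its lineage is a pure three-leg push from its BIRTH level (no four-channel step).
* §4 PER LINEAGE: **`legChain_sub_respStep_of_lt`** (`i < k`: `T_i − B_i = (μ,z,κ,u) ↦ dz (λ_i μ z) κ u`, `B_i = respStep (Lc^i) (Lc^k)`,
  `λ_i μ z = Psi ρ Lc i (k−1−i) (delta1 μ z) − bmGaugeAt ρ (B_i μ z) Lc`) and **`unitS_bornLam_eq_undressed_add_contact`** — the Λ-born remainder in units
  = fresh Λ-source + Σ_{i<k} weight • (UNDRESSED one-shot push `push₃ B_i B_i B_i`) + Σ_{i<k} weight • (CONTACT `push₃ T_i T_i T_i − push₃ B_i B_i B_i`).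
  The first sum is (V3)-Λ's object (road S3's geometric row Λ, to be read in this currency); each contact summand is the instance of leaf-02-g47's socket
  `contact_lambda_eq_cells` with `lᴱ = rᴱ = wᴱ = T_i`, `lᴮ = rᴮ = wᴮ = B_i`, `λ_L = λ_R = λ_W = λ_i` (one line once that module is in the tree).
* §5 **`exists_hBLam_of_letters`** — the Λ-born row `hB(0, cΛ)` as a THREE-LETTER SOCKET: (V7) in `LocStencil` form for the born Λ-pieces, (V3)-Λ for the weighted
  undressed lineages, and the weighted contact terms — each uniform in the root and the level; **`exists_hBLam_of_letters_three`** (`d = 3`): the first letter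
  DISCHARGED (§2), two remain.  The load-bearing question of (V8) (the owner's attack surface (i):
  the sums over `i < k` must be bounded UNIFORMLY in `k`, i.e. the summands must decay in `k − i` IN UNITS) is exactly the content of `hU` and `hC`; nothing of it is
  claimed here.
Discharges NO slot letter; asserts NO shape of Bałaban's stencils; NO estimate; 0 wall binders; NEVER «G-an2-4 closed»; NOT D1, NOT BetaPertH, NOT continuum, NOT Clay.
-/

noncomputable section

open Finset
open scoped BigOperators
open Literature.MathematicalPhysics.QuantumFieldTheory
open Literature.MathematicalPhysics.QuantumFieldTheory.Balaban1983to89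
open Literature.MathematicalPhysics.QuantumFieldTheory.Balaban1983to89.Beta
open ExpKernelCalculus (MKer VertexFamily Zl Zl_nonneg)
open AffineAveraging (box toSite dz)
open OneStepResolventKernel (Fib LocStencil KInv decays_KInv)
open OneStepKernelFamily (KInvStep)
open BalabanStepJetsSucc (wΛ E2 lamCoeffK)
open StepJetData (locStencil_add locStencil_smul)
open BalabanStepJets (lamCoeffOf abs_lamCoeffOf_le locStencil_mono)
open AveragingHessianKernels (ell)
open AveragingHessianKernelsRooted (vhSAt hessFFAt biLoc_hessFFAt)
open InterLevelTransport (SLam locStencil_SLam)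
open KKTFluctuationKernel (delta1)
open BalabanCompositeJets (respStep)
open Summit.QuantumFields.BalabanUV.Beta.AxialProjectorBlockMean (bmGaugeAt)
open Summit.QuantumFields.BalabanUV.Beta.HessKerDressedUnits (unitS unitS_one locStencil_unitS)
open Summit.QuantumFields.BalabanUV.Beta.GAN24.CombesThomas (sfStep smStep KStepUnit UnitDecayK)
open Summit.QuantumFields.BalabanUV.Beta.GAN24.StencilSlotOfShapes (unitS_add locStencil_mono')
open Summit.QuantumFields.BalabanUV.Beta.GAN24.Push4 (IsFF)
open Summit.QuantumFields.BalabanUV.Beta.GAN24.Push4Iter (LegFam legChain)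
open Summit.QuantumFields.BalabanUV.Beta.GAN24.Push3 (push₃)
open Summit.QuantumFields.BalabanUV.Beta.GAN24.AffineUnroll (transport transport_zero transport_succ transport_add)
open Summit.QuantumFields.BalabanUV.Beta.GAN24.RespStepBmDecompExact (respStepBmSeq)
open Summit.QuantumFields.BalabanUV.Beta.GAN24.RespStepBmDecompPsi (Psi)
open Summit.QuantumFields.BalabanUV.Beta.GAN24.SrecWilsonSector (bornSecAt isFF_unitS)
open Summit.QuantumFields.BalabanUV.Beta.GAN24.SrecBornSector (freshAt stepMap unitStepMap bornSecAt_eq_sum_transport isLoc_add isLoc_stepMap stepMap_add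
  isLoc_freshAt unitS_bornSecAt_eq_sum transport_unitStepMap_succ_eq_push₃)
open Summit.QuantumFields.BalabanUV.Beta.GAN24.ContactKernelCells (legChain_respStepBmSeq_sub_respStep)
open Summit.QuantumFields.BalabanUV.Beta.GAN24.StencilSlotLamRoot (SLam_hessFFAt_inl_inr SLam_hessFFAt_inr_inl SLam_hessFFAt_inr_inr unitS_lamPiece_eq
  locStencil_unitS_lamPiece)
open Summit.QuantumFields.BalabanUV.Beta.GAN24.FibreStrip (unitDecayK_holds)

namespace Summit.QuantumFields.BalabanUV.Beta.GAN24.BornLambdaLineage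

variable {d : ℕ} {Lc : ℕ} [NeZero Lc]

/-! ## §1 The remainder splits by sector -/

/-- [folklore] **THE SOURCES SPLIT BY SECTOR**: member `j`'s source is its V-source (`cΛ := 0`) plus its Λ-source (`cVH := 0`). -/
theorem freshAt_add (ρ : Fin (d + 1) → ℤ) (cVH cΛ : ℝ) (j : ℕ) :
    freshAt Lc ρ cVH cΛ j = freshAt Lc ρ cVH 0 j + freshAt Lc ρ 0 cΛ j := by
  funext κ u
  cases j with
  | zero => simp only [freshAt, Pi.add_apply, zero_smul, add_zero, zero_add]
  | succ j => simp only [freshAt, Pi.add_apply, zero_mul, zero_smul, add_zero, zero_add]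

/-- NOT IN PRINT; OUR BOOKKEEPING.  **THE REMAINDER SPLITS BY SECTOR** (in-block root): `bornSecAt Lc ρ cE cVH cΛ k = bornSecAt Lc ρ cE cVH 0 k + bornSecAt Lc ρ cE 0 cΛ k`
— the decoupled affine recursion unrolled (leaf-03's `bornSecAt_eq_sum_transport`) is additive in its sources on the class of local stencil families
(`AffineUnroll.transport_add` with leaf-03's `isLoc_stepMap` ∕ `stepMap_add` ∕ `isLoc_freshAt`). -/
theorem bornSecAt_add_sectors {rr : Fin (d + 1) → ℕ} (hrr : rr ∈ box (d + 1) Lc) (cE cVH cΛ : ℝ) (k : ℕ) :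
    bornSecAt Lc (toSite rr) cE cVH cΛ k = bornSecAt Lc (toSite rr) cE cVH 0 k + bornSecAt Lc (toSite rr) cE 0 cΛ k := by
  have hadd : ∀ m n j, transport (stepMap Lc (toSite rr) cE) m n (freshAt Lc (toSite rr) cVH cΛ j)
      = transport (stepMap Lc (toSite rr) cE) m n (freshAt Lc (toSite rr) cVH 0 j)
        + transport (stepMap Lc (toSite rr) cE) m n (freshAt Lc (toSite rr) 0 cΛ j) := by
    intro m n j
    rw [freshAt_add]
    exact transport_add (A := stepMap Lc (toSite rr) cE) (P := fun S => ∃ Cs δ : ℝ, 0 < δ ∧ LocStencil S Cs δ)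
      (fun j x hx => isLoc_stepMap hrr cE j hx) (fun j x y hx hy => stepMap_add hrr cE j hx hy) m n
      (isLoc_freshAt hrr cE cVH 0 j) (isLoc_freshAt hrr cE 0 cΛ j)
  rw [bornSecAt_eq_sum_transport hrr cE cVH cΛ k, bornSecAt_eq_sum_transport hrr cE cVH 0 k,
    bornSecAt_eq_sum_transport hrr cE 0 cΛ k, hadd, Finset.sum_congr rfl fun m _ => hadd _ _ _, Finset.sum_add_distrib]
  abel

/-- NOT IN PRINT; OUR BOOKKEEPING.  **THE TARGET SPLITS BY SECTOR**: a uniform `LocStencil` letter for the unit tables of the V-born remainder (`cΛ := 0`) and one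
for the Λ-born remainder (`cVH := 0`) give the letter `hB` of the owner's socket `SrecAtRowOfSectors.exists_hS0_SrecAt_of_sectors` for the full remainder
(constants added, the common rate). -/
theorem exists_hB_of_sectors (cE cVH cΛ : ℝ)
    (hV : ∃ C δ : ℝ, 0 < δ ∧ ∀ (rr : Fin (d + 1) → ℕ), rr ∈ box (d + 1) Lc →
      ∀ j : ℕ, LocStencil (unitS (sfStep Lc j) (smStep d Lc j) (bornSecAt Lc (toSite rr) cE cVH 0 j)) C δ)
    (hL : ∃ C δ : ℝ, 0 < δ ∧ ∀ (rr : Fin (d + 1) → ℕ), rr ∈ box (d + 1) Lc →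
      ∀ j : ℕ, LocStencil (unitS (sfStep Lc j) (smStep d Lc j) (bornSecAt Lc (toSite rr) cE 0 cΛ j)) C δ) :
    ∃ C δ : ℝ, 0 < δ ∧ ∀ (rr : Fin (d + 1) → ℕ), rr ∈ box (d + 1) Lc →
      ∀ j : ℕ, LocStencil (unitS (sfStep Lc j) (smStep d Lc j) (bornSecAt Lc (toSite rr) cE cVH cΛ j)) C δ := by
  obtain ⟨CV, δV, hδV, hV⟩ := hV
  obtain ⟨CL, δL, hδL, hL⟩ := hL
  refine ⟨CV + CL, min δV δL, lt_min hδV hδL, fun rr hrr j => ?_⟩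
  have hCV : 0 ≤ CV := ((hV rr hrr j) 0 0).nonneg (Sum.inl 0)
  have hCL : 0 ≤ CL := ((hL rr hrr j) 0 0).nonneg (Sum.inl 0)
  have e : unitS (sfStep Lc j) (smStep d Lc j) (bornSecAt Lc (toSite rr) cE cVH cΛ j) = fun κ u =>
      unitS (sfStep Lc j) (smStep d Lc j) (bornSecAt Lc (toSite rr) cE cVH 0 j) κ u
        + unitS (sfStep Lc j) (smStep d Lc j) (bornSecAt Lc (toSite rr) cE 0 cΛ j) κ u := by
    rw [bornSecAt_add_sectors hrr cE cVH cΛ j]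
    exact unitS_add _ _ _ _
  rw [e]
  exact locStencil_add (locStencil_mono (hV rr hrr j) hCV (min_le_left _ _)) (locStencil_mono (hL rr hrr j) hCL (min_le_right _ _))

/-! ## §2 The Λ-source in the adopted units is a Λ-piece of the UNIT-NORMALISED step resolvents with a `j`-free weight; its `j`-uniform locality -/

section Units

/-- [folklore] The Λ-source of member `0`: `freshAt Lc ρ 0 cΛ 0 = cΛ • SLam Lc (lamCoeffOf (KInv Lc) Lc) H_ρ`. -/
theorem freshAt_lam_zero (ρ : Fin (d + 1) → ℤ) (cΛ : ℝ) :
    freshAt Lc ρ 0 cΛ 0 = fun κ u => cΛ • SLam Lc (lamCoeffOf (KInv (N := Lc) (d := d)) Lc) (fun μ y => hessFFAt ρ Lc μ y) κ u := by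
  funext κ u
  simp only [freshAt, zero_smul, zero_add]

/-- [folklore] The Λ-source of member `j+1`: `freshAt Lc ρ 0 cΛ (j+1) = (cΛ·wΛ (j+1)) • SLam Lc (lamCoeffK (KInvStep Lc (j+1)) (E2 (j+1)) Lc) H_ρ`. -/
theorem freshAt_lam_succ (ρ : Fin (d + 1) → ℤ) (cΛ : ℝ) (j : ℕ) :
    freshAt Lc ρ 0 cΛ (j + 1) = fun κ u => (cΛ * wΛ d Lc (j + 1)) •
      SLam Lc (lamCoeffK (KInvStep (d := d) Lc (j + 1)) (E2 d Lc (j + 1)) Lc) (fun μ y => hessFFAt ρ Lc μ y) κ u := by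
  funext κ u
  simp only [freshAt, zero_mul, zero_smul, zero_add]

/-- NOT IN PRINT; OUR BOOKKEEPING.  **THE Λ-SOURCE OF MEMBER `0` IN UNITS** (`sfStep Lc 0 = smStep d Lc 0 = 1`: asym1's `unitS_one`): the bare Λ-piece
`cΛ • SLam Lc (lamCoeffOf (KInv Lc) Lc) H_ρ`. -/
theorem unitS_freshAt_lam_zero (ρ : Fin (d + 1) → ℤ) (cΛ : ℝ) :
    unitS (sfStep Lc 0) (smStep d Lc 0) (freshAt Lc ρ 0 cΛ 0)
      = fun κ u => cΛ • SLam Lc (lamCoeffOf (KInv (N := Lc) (d := d)) Lc) (fun μ y => hessFFAt ρ Lc μ y) κ u := by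
  rw [freshAt_lam_zero, show sfStep Lc 0 = 1 by simp [sfStep], show smStep d Lc 0 = 1 by simp [smStep], unitS_one]

/-- NOT IN PRINT; OUR BOOKKEEPING.  **THE Λ-SOURCE OF MEMBER `j+1` IN ITS OWN UNITS IS THE Λ-PIECE OF THE UNIT-NORMALISED STEP RESOLVENTS WITH THE
`j`-FREE WEIGHT `cΛ·Lc^{2(d+1)}`** (the row owner's `StencilSlotLamRoot.unitS_lamPiece_eq` BY NAME):
`unitS_{j+1} (freshAt Lc ρ 0 cΛ (j+1)) = (cΛ·Lc^{2(d+1)}) • SLam Lc (lamCoeffK (KStepUnit Lc (j+1)) ((smStep d Lc j)² • E2 d Lc (j+1)) Lc) H_ρ` — so the unit letter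
(V7) the assembly needs is the decay of THESE coefficients, i.e. road P1's `UnitDecayK` (`locStencil_unitS_lamPiece`). -/
theorem unitS_freshAt_lam_succ (ρ : Fin (d + 1) → ℤ) (cΛ : ℝ) (j : ℕ) :
    unitS (sfStep Lc (j + 1)) (smStep d Lc (j + 1)) (freshAt Lc ρ 0 cΛ (j + 1))
      = fun κ u => (cΛ * (Lc : ℝ) ^ (2 * (d + 1))) •
          SLam Lc (lamCoeffK (KStepUnit (d := d) Lc (j + 1)) ((smStep d Lc j) ^ 2 • E2 d Lc (j + 1)) Lc)
            (fun μ y => hessFFAt ρ Lc μ y) κ u := by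
  rw [freshAt_lam_succ]
  exact unitS_lamPiece_eq ρ cΛ j

/-- [folklore] A Λ-piece at the rooted constraint Hessians is ff-valued (the owner's block lemmas `SLam_hessFFAt_inl_inr ∕ _inr_inl ∕ _inr_inr`). -/
theorem isFF_SLam_hessFFAt {N : ℕ} [NeZero N] (ρ : Fin (d + 1) → ℤ) (L : ℕ)
    (c : Fin (d + 1) → (Fin (d + 1) → ℤ) → Fin (d + 1) → (Fin (d + 1) → ℤ) → ℝ) (κ : Fin (d + 1)) (u : Fin (d + 1) → ℤ) :
    IsFF (SLam N c (fun μ y => hessFFAt ρ L μ y) κ u) :=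
  ⟨fun x z μ' b => by
    rcases b with α | ν'
    · exact SLam_hessFFAt_inr_inl c ρ L κ u x z μ' α
    · exact SLam_hessFFAt_inr_inr c ρ L κ u x z μ' ν',
    fun x z p ν' => by
    rcases p with α | μ'
    · exact SLam_hessFFAt_inl_inr c ρ L κ u x z α ν'
    · exact SLam_hessFFAt_inr_inr c ρ L κ u x z μ' ν'⟩

/-- [folklore] The Λ-source is ff-valued at every level. -/
theorem isFF_freshAt_lam (ρ : Fin (d + 1) → ℤ) (cΛ : ℝ) :
    ∀ (j : ℕ) (κ : Fin (d + 1)) (u : Fin (d + 1) → ℤ), IsFF (freshAt Lc ρ 0 cΛ j κ u)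
  | 0, κ, u => by
    rw [freshAt_lam_zero]
    exact SrecWilsonSector.isFF_smul (isFF_SLam_hessFFAt ρ Lc _ κ u) _
  | j + 1, κ, u => by
    rw [freshAt_lam_succ]
    exact SrecWilsonSector.isFF_smul (isFF_SLam_hessFFAt ρ Lc _ κ u) _

/-- [folklore] The Λ-source in units is in the class of local stencil families (in-block root; leaf-03's `isLoc_freshAt` + asym1's `locStencil_unitS`). -/
theorem isLoc_unitS_freshAt_lam {rr : Fin (d + 1) → ℕ} (hrr : rr ∈ box (d + 1) Lc) (cE cΛ : ℝ) (j : ℕ) (sf sm : ℝ) :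
    ∃ Cs δ : ℝ, 0 < δ ∧ LocStencil (unitS sf sm (freshAt Lc (toSite rr) 0 cΛ j)) Cs δ := by
  obtain ⟨C, δ, hδ, h⟩ := isLoc_freshAt hrr cE 0 cΛ j
  exact ⟨_, δ, hδ, locStencil_unitS h⟩

/-- [folklore] **MEMBER `0`'s Λ-PIECE IS LOCAL, UNIFORMLY IN THE IN-BLOCK ROOT** (the Λ third of an2's `SpineRootedS0N.locStencil_S0NAt`: `decays_KInv`,
`abs_lamCoeffOf_le`, an1's rooted `biLoc_hessFFAt`, `locStencil_SLam`; the constant and the rate do not see the root). -/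
theorem exists_locStencil_lamPiece_zero (hLc : 1 ≤ Lc) (cΛ : ℝ) :
    ∃ C δ : ℝ, 0 < δ ∧ ∀ (rr : Fin (d + 1) → ℕ), rr ∈ box (d + 1) Lc →
      LocStencil (fun κ u => cΛ • SLam Lc (lamCoeffOf (KInv (N := Lc) (d := d)) Lc) (fun μ y => hessFFAt (toSite rr) Lc μ y) κ u) C δ := by
  obtain ⟨δ₀, C, hδ₀, hC, hdec⟩ := decays_KInv (N := Lc) (d := d)
  have hc := abs_lamCoeffOf_le (N := Lc) hdec hC hδ₀.le
  refine ⟨|cΛ| * ((d + 1 : ℕ) * (((3 : ℝ) ^ (d + 1) * ((d + 1 : ℕ) : ℝ) * (16 * ((d + 1 : ℕ) : ℝ)) * C * Real.exp (((d + 1 : ℕ) : ℝ) * δ₀))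
      * (2 * (ell (d + 1) Lc : ℝ) ^ 2 * Real.exp (4 * ((d : ℝ) + 1) * Lc * δ₀)) * Zl (d + 1) (δ₀ / 2))),
    δ₀ / 2, by positivity, fun rr hrr => ?_⟩
  have hQ : VertexFamily (fun μ y => hessFFAt (toSite rr) Lc μ y) Lc
      (2 * (ell (d + 1) Lc : ℝ) ^ 2 * Real.exp (4 * ((d : ℝ) + 1) * Lc * δ₀)) δ₀ :=
    fun μ y => biLoc_hessFFAt hLc μ y hrr hδ₀.le
  have h3 := locStencil_SLam (N := Lc) hc hQ hδ₀ (mul_nonneg (mul_nonneg (by positivity) hC) (Real.exp_pos _).le)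
  exact locStencil_smul cΛ h3

/-- NOT IN PRINT; OUR BOOKKEEPING ((V7) in `LocStencil` form, generic `d`, CONDITIONAL on road P1's unit decay `UnitDecayK`).  **THE BORN Λ-PIECES ARE LOCAL STENCIL
FAMILIES IN THEIR OWN UNITS WITH ONE CONSTANT AND ONE RATE FOR ALL LEVELS AND ALL IN-BLOCK ROOTS**: member `0` by `exists_locStencil_lamPiece_zero`, member `j+1`
by the owner's `StencilSlotLamRoot.locStencil_unitS_lamPiece` (j-free constant) — the letter `hX` of §5. -/
theorem exists_hX_lam_of_unitDecayK (hLc : 1 ≤ Lc) {CK δK : ℝ} (hK : UnitDecayK d Lc (sfStep Lc) (smStep d Lc) CK δK) (hδK : 0 < δK) (cΛ : ℝ) :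
    ∃ C δ : ℝ, 0 < δ ∧ ∀ (rr : Fin (d + 1) → ℕ), rr ∈ box (d + 1) Lc →
      ∀ k : ℕ, LocStencil (unitS (sfStep Lc k) (smStep d Lc k) (freshAt Lc (toSite rr) 0 cΛ k)) C δ := by
  obtain ⟨C0, δ0, hδ0, h0⟩ := exists_locStencil_lamPiece_zero (d := d) hLc cΛ
  -- the j-free constant of the owner's `locStencil_unitS_lamPiece`
  set C1 : ℝ := |cΛ * (Lc : ℝ) ^ (2 * (d + 1))| *
    ((d + 1 : ℕ) * (((Fintype.card (Fib d) : ℝ) * (CK * CK) * Zl (d + 1) (δK - δK / 2)) *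
      (2 * (ell (d + 1) Lc : ℝ) ^ 2 * Real.exp (4 * ((d : ℝ) + 1) * Lc * (δK / 2))) * Zl (d + 1) (δK / 2 / 2))) with hC1
  refine ⟨max C0 C1, min δ0 (δK / 2 / 2), lt_min hδ0 (by positivity), fun rr hrr k => ?_⟩
  cases k with
  | zero =>
    rw [unitS_freshAt_lam_zero]
    exact locStencil_mono' (h0 rr hrr) (le_max_left _ _) (min_le_left _ _)
  | succ j =>
    rw [freshAt_lam_succ]
    exact locStencil_mono' (locStencil_unitS_lamPiece hLc hrr hK hδK cΛ j) (le_max_right _ _) (min_le_right _ _)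

/-- NOT IN PRINT; OUR BOOKKEEPING ((V7) in `LocStencil` form, `d = 3`, UNCONDITIONAL).  **THE BORN Λ-PIECES OF THE `d = 3` FAMILY ARE LOCAL STENCIL FAMILIES IN
THEIR OWN UNITS, UNIFORMLY IN THE LEVEL AND THE IN-BLOCK ROOT** — road P1's (I3′) `FibreStrip.unitDecayK_holds` discharges the unit decay. -/
theorem exists_hX_lam_three {Lc : ℕ} [NeZero Lc] (cΛ : ℝ) :
    ∃ C δ : ℝ, 0 < δ ∧ ∀ (rr : Fin (3 + 1) → ℕ), rr ∈ box (3 + 1) Lc →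
      ∀ k : ℕ, LocStencil (unitS (sfStep Lc k) (smStep 3 Lc k) (freshAt Lc (toSite rr) 0 cΛ k)) C δ := by
  obtain ⟨κ, hκ, Cst, hK⟩ := unitDecayK_holds (Lc := Lc)
  have hLc : 1 ≤ Lc := Nat.one_le_iff_ne_zero.2 (NeZero.ne Lc)
  have hrate : 0 < κ / ((3 + 1) * (Lc : ℝ)) := by
    have : (0 : ℝ) < (Lc : ℝ) := by exact_mod_cast Nat.pos_of_ne_zero (NeZero.ne Lc)
    positivity
  exact exists_hX_lam_of_unitDecayK (d := 3) hLc hK hrate cΛ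

end Units


/-! ## §3 The Λ-born remainder in units: a sum over birth levels of weighted three-leg pushes from the birth level -/

/-- NOT IN PRINT; OUR BOOKKEEPING.  **leaf-03's CLOSED FORM RE-INDEXED OVER THE BIRTH LEVELS** (in-block root; every `cVH`, `cΛ`):
`unitS_k (bornSecAt k) = Σ_{i ∈ range (k+1)} transport unitStepMap i (k − i) (unitS_i (freshAt i))` — birth level `i`, transported `k − i` steps
(the `i = k` summand is the fresh source of member `k` itself). -/
theorem unitS_bornSecAt_eq_sum_range {rr : Fin (d + 1) → ℕ} (hrr : rr ∈ box (d + 1) Lc) (cE cVH cΛ : ℝ) (k : ℕ) :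
    unitS (sfStep Lc k) (smStep d Lc k) (bornSecAt Lc (toSite rr) cE cVH cΛ k)
      = ∑ i ∈ Finset.range (k + 1), transport (unitStepMap Lc (toSite rr) cE) i (k - i)
          (unitS (sfStep Lc i) (smStep d Lc i) (freshAt Lc (toSite rr) cVH cΛ i)) := by
  rw [unitS_bornSecAt_eq_sum hrr cE cVH cΛ k, Finset.sum_range_succ', Nat.sub_zero]
  refine (add_comm _ _).trans ?_
  congr 1
  refine Finset.sum_congr rfl fun m _ => ?_
  rw [show k - 1 - m = k - (m + 1) by omega]

/-- NOT IN PRINT; OUR BOOKKEEPING ((V8) instance side, Λ sector; [folklore]).  **THE Λ-BORN REMAINDER OF THE RECURSIVE FAMILY, MEMBER `k`, IN THE ADOPTED UNITS,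
IS THE FRESH Λ-SOURCE PLUS A SUM OVER EARLIER BIRTH LEVELS OF WEIGHTED THREE-LEG PUSHES OF THE BORN Λ-PIECES THROUGH THE DRESSED LEG CHAINS FROM THEIR BIRTH LEVEL**
(in-block root): `unitS_k (bornSecAt Lc ρ cE 0 cΛ k) = unitS_k (freshAt Lc ρ 0 cΛ k) + Σ_{i<k} (cE·Lc^{2(d+1)})^{k−i} • push₃ T_i T_i T_i (unitS_i (freshAt Lc ρ 0 cΛ i))`,
`T_i = legChain (respStepBmSeq ρ Lc) i (k−1−i)` — the Λ-piece is ff-valued, so (leaf-03's `transport_unitStepMap_succ_eq_push₃` at base `m = i`) its transport is ONE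
push from the FIRST step on; the born tables `unitS_i (freshAt Lc ρ 0 cΛ i)` are the Λ-pieces of §2 with displayed coefficients. -/
theorem unitS_bornLam_eq_sum_push₃ {rr : Fin (d + 1) → ℕ} (hrr : rr ∈ box (d + 1) Lc) (cE cΛ : ℝ) (k : ℕ) :
    unitS (sfStep Lc k) (smStep d Lc k) (bornSecAt Lc (toSite rr) cE 0 cΛ k)
      = unitS (sfStep Lc k) (smStep d Lc k) (freshAt Lc (toSite rr) 0 cΛ k)
        + ∑ i ∈ Finset.range k, fun κ' u' => (cE * (Lc : ℝ) ^ (2 * (d + 1))) ^ (k - i) •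
            push₃ (legChain (respStepBmSeq (toSite rr) Lc) i (k - 1 - i)) (legChain (respStepBmSeq (toSite rr) Lc) i (k - 1 - i))
              (legChain (respStepBmSeq (toSite rr) Lc) i (k - 1 - i)) (unitS (sfStep Lc i) (smStep d Lc i) (freshAt Lc (toSite rr) 0 cΛ i)) κ' u' := by
  rw [unitS_bornSecAt_eq_sum_range hrr cE 0 cΛ k, Finset.sum_range_succ, Nat.sub_self, transport_zero]
  refine (add_comm _ _).trans ?_
  congr 1
  refine Finset.sum_congr rfl fun i hi => ?_
  have hik : i < k := Finset.mem_range.1 hi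
  obtain ⟨n, hn⟩ : ∃ n, k - i = n + 1 := ⟨k - 1 - i, by omega⟩
  have hn' : k - 1 - i = n := by omega
  rw [hn, hn', transport_unitStepMap_succ_eq_push₃ hrr cE i (fun κ u => isFF_unitS (isFF_freshAt_lam (toSite rr) cΛ i) _ _ κ u)
    (isLoc_unitS_freshAt_lam hrr cE cΛ i _ _) n]

/-! ## §4 Per lineage: the undressed one-shot push plus the contact term, with the pure-gauge family displayed -/

/-- NOT IN PRINT; OUR BOOKKEEPING.  **THE LEG DIFFERENCE OF THE LINEAGE BORN AT LEVEL `i < k` IS ONE PURE-GAUGE FAMILY** (leaf-01 g58's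
`ContactKernelCells.legChain_respStepBmSeq_sub_respStep` at `i + (k−1−i) + 1 = k`): `T_i − B_i = (μ, z, κ, u) ↦ dz (λ_i μ z) κ u` with
`B_i = respStep (Lc^i) (Lc^k)` and `λ_i μ z = Psi ρ Lc i (k−1−i) (delta1 μ z) − bmGaugeAt ρ (B_i μ z) Lc` — the hypotheses `hL = hR = hW` of leaf-02's
`contact_lambda_eq_cells` for this lineage. -/
theorem legChain_sub_respStep_of_lt {rr : Fin (d + 1) → ℕ} (hrr : rr ∈ box (d + 1) Lc) {i k : ℕ} (hik : i < k) :
    legChain (respStepBmSeq (d := d) (toSite rr) Lc) i (k - 1 - i) - respStep (d := d) (Lc ^ i) (Lc ^ k)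
      = fun μ z κ u => dz (Psi (toSite rr) Lc i (k - 1 - i) (delta1 μ z)
          - bmGaugeAt (toSite rr) (respStep (d := d) (Lc ^ i) (Lc ^ k) μ z) Lc) κ u := by
  have hk : i + (k - 1 - i) + 1 = k := by omega
  have h := legChain_respStepBmSeq_sub_respStep (d := d) hrr i (k - 1 - i)
  rw [hk] at h
  exact h

/-- NOT IN PRINT; OUR BOOKKEEPING ((V8) instance side, Λ sector; [folklore]).  **THE Λ-BORN REMAINDER IN UNITS = FRESH SOURCE + UNDRESSED LINEAGES + CONTACT TERMS**
(in-block root): with `X_i := unitS_i (freshAt Lc ρ 0 cΛ i)` (the Λ-pieces of §2), `w_i := (cE·Lc^{2(d+1)})^{k−i}`, `T_i = legChain (respStepBmSeq ρ Lc) i (k−1−i)`,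
`B_i = respStep (Lc^i) (Lc^k)`,
`unitS_k (bornSecAt Lc ρ cE 0 cΛ k) = X_k + Σ_{i<k} w_i • push₃ B_i B_i B_i X_i + Σ_{i<k} w_i • (push₃ T_i T_i T_i X_i − push₃ B_i B_i B_i X_i)`.
The middle sum is the UNDRESSED Λ row ((V3)-Λ: road S3's `TaylorRowLam.rowL_three` object, to be read in this currency); each summand of the last sum is the
contact term of one lineage, whose three leg differences are the pure-gauge family of `legChain_sub_respStep_of_lt`. -/
theorem unitS_bornLam_eq_undressed_add_contact {rr : Fin (d + 1) → ℕ} (hrr : rr ∈ box (d + 1) Lc) (cE cΛ : ℝ) (k : ℕ) :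
    unitS (sfStep Lc k) (smStep d Lc k) (bornSecAt Lc (toSite rr) cE 0 cΛ k)
      = unitS (sfStep Lc k) (smStep d Lc k) (freshAt Lc (toSite rr) 0 cΛ k)
        + ∑ i ∈ Finset.range k, (fun κ' u' => (cE * (Lc : ℝ) ^ (2 * (d + 1))) ^ (k - i) •
            push₃ (respStep (d := d) (Lc ^ i) (Lc ^ k)) (respStep (d := d) (Lc ^ i) (Lc ^ k)) (respStep (d := d) (Lc ^ i) (Lc ^ k))
              (unitS (sfStep Lc i) (smStep d Lc i) (freshAt Lc (toSite rr) 0 cΛ i)) κ' u')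
        + ∑ i ∈ Finset.range k, (fun κ' u' => (cE * (Lc : ℝ) ^ (2 * (d + 1))) ^ (k - i) •
            (push₃ (legChain (respStepBmSeq (toSite rr) Lc) i (k - 1 - i)) (legChain (respStepBmSeq (toSite rr) Lc) i (k - 1 - i))
                (legChain (respStepBmSeq (toSite rr) Lc) i (k - 1 - i)) (unitS (sfStep Lc i) (smStep d Lc i) (freshAt Lc (toSite rr) 0 cΛ i)) κ' u'
              - push₃ (respStep (d := d) (Lc ^ i) (Lc ^ k)) (respStep (d := d) (Lc ^ i) (Lc ^ k)) (respStep (d := d) (Lc ^ i) (Lc ^ k))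
                (unitS (sfStep Lc i) (smStep d Lc i) (freshAt Lc (toSite rr) 0 cΛ i)) κ' u')) := by
  rw [unitS_bornLam_eq_sum_push₃ hrr cE cΛ k, add_assoc, ← Finset.sum_add_distrib]
  congr 1
  refine Finset.sum_congr rfl fun i _ => ?_
  funext κ' u'
  simp only [Pi.add_apply, smul_sub, add_sub_cancel]

/-! ## §5 The Λ-born target as a three-letter socket -/

/-- NOT IN PRINT; OUR BOOKKEEPING ((V8) socket, Λ sector).  **THE Λ-BORN ROW FROM THREE LETTERS**: a `j`-uniform `LocStencil` letter for the born Λ-pieces in their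
own units (`hX` — the `LocStencil` form of the unit letter (V7)), one for the UNDRESSED Λ lineages summed over the birth levels with the weights
`(cE·Lc^{2(d+1)})^{k−i}` (`hU` — (V3)-Λ, road S3's geometric row Λ read in this currency) and one for the CONTACT terms summed the same way (`hC` — the cells),
all uniform in the in-block root and the level, give the letter `hB(0, cΛ)` of `exists_hB_of_sectors` (constants added at the common rate; §4's identity). -/
theorem exists_hBLam_of_letters (cE cΛ : ℝ)
    (hX : ∃ C δ : ℝ, 0 < δ ∧ ∀ (rr : Fin (d + 1) → ℕ), rr ∈ box (d + 1) Lc →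
      ∀ k : ℕ, LocStencil (unitS (sfStep Lc k) (smStep d Lc k) (freshAt Lc (toSite rr) 0 cΛ k)) C δ)
    (hU : ∃ C δ : ℝ, 0 < δ ∧ ∀ (rr : Fin (d + 1) → ℕ), rr ∈ box (d + 1) Lc → ∀ k : ℕ,
      LocStencil (∑ i ∈ Finset.range k, fun κ' u' => (cE * (Lc : ℝ) ^ (2 * (d + 1))) ^ (k - i) •
        push₃ (respStep (d := d) (Lc ^ i) (Lc ^ k)) (respStep (d := d) (Lc ^ i) (Lc ^ k)) (respStep (d := d) (Lc ^ i) (Lc ^ k))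
          (unitS (sfStep Lc i) (smStep d Lc i) (freshAt Lc (toSite rr) 0 cΛ i)) κ' u') C δ)
    (hC : ∃ C δ : ℝ, 0 < δ ∧ ∀ (rr : Fin (d + 1) → ℕ), rr ∈ box (d + 1) Lc → ∀ k : ℕ,
      LocStencil (∑ i ∈ Finset.range k, fun κ' u' => (cE * (Lc : ℝ) ^ (2 * (d + 1))) ^ (k - i) •
        (push₃ (legChain (respStepBmSeq (toSite rr) Lc) i (k - 1 - i)) (legChain (respStepBmSeq (toSite rr) Lc) i (k - 1 - i))
            (legChain (respStepBmSeq (toSite rr) Lc) i (k - 1 - i)) (unitS (sfStep Lc i) (smStep d Lc i) (freshAt Lc (toSite rr) 0 cΛ i)) κ' u'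
          - push₃ (respStep (d := d) (Lc ^ i) (Lc ^ k)) (respStep (d := d) (Lc ^ i) (Lc ^ k)) (respStep (d := d) (Lc ^ i) (Lc ^ k))
            (unitS (sfStep Lc i) (smStep d Lc i) (freshAt Lc (toSite rr) 0 cΛ i)) κ' u')) C δ) :
    ∃ C δ : ℝ, 0 < δ ∧ ∀ (rr : Fin (d + 1) → ℕ), rr ∈ box (d + 1) Lc →
      ∀ k : ℕ, LocStencil (unitS (sfStep Lc k) (smStep d Lc k) (bornSecAt Lc (toSite rr) cE 0 cΛ k)) C δ := by
  obtain ⟨CX, δX, hδX, hX⟩ := hX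
  obtain ⟨CU, δU, hδU, hU⟩ := hU
  obtain ⟨CC, δC, hδC, hC⟩ := hC
  refine ⟨CX + CU + CC, min (min δX δU) δC, lt_min (lt_min hδX hδU) hδC, fun rr hrr k => ?_⟩
  have hCX : 0 ≤ CX := ((hX rr hrr k) 0 0).nonneg (Sum.inl 0)
  have hCU : 0 ≤ CU := ((hU rr hrr k) 0 0).nonneg (Sum.inl 0)
  have hCC : 0 ≤ CC := ((hC rr hrr k) 0 0).nonneg (Sum.inl 0)
  rw [unitS_bornLam_eq_undressed_add_contact hrr cE cΛ k]
  have h1 := locStencil_mono (hX rr hrr k) hCX (show min (min δX δU) δC ≤ δX from (min_le_left _ _).trans (min_le_left _ _))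
  have h2 := locStencil_mono (hU rr hrr k) hCU (show min (min δX δU) δC ≤ δU from (min_le_left _ _).trans (min_le_right _ _))
  have h3 := locStencil_mono (hC rr hrr k) hCC (show min (min δX δU) δC ≤ δC from min_le_right _ _)
  exact locStencil_add (locStencil_add h1 h2) h3

/-- NOT IN PRINT; OUR BOOKKEEPING ((V8) socket, Λ sector, `d = 3`: the first letter DISCHARGED).  **THE Λ-BORN ROW OF THE `d = 3` FAMILY FROM TWO LETTERS** —
the weighted UNDRESSED lineages (`hU`, (V3)-Λ) and the weighted CONTACT terms (`hC`); the born Λ-pieces' own `j`-uniform locality is `exists_hX_lam_three`. -/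
theorem exists_hBLam_of_letters_three {Lc : ℕ} [NeZero Lc] (cE cΛ : ℝ)
    (hU : ∃ C δ : ℝ, 0 < δ ∧ ∀ (rr : Fin (3 + 1) → ℕ), rr ∈ box (3 + 1) Lc → ∀ k : ℕ,
      LocStencil (∑ i ∈ Finset.range k, fun κ' u' => (cE * (Lc : ℝ) ^ (2 * (3 + 1))) ^ (k - i) •
        push₃ (respStep (d := 3) (Lc ^ i) (Lc ^ k)) (respStep (d := 3) (Lc ^ i) (Lc ^ k)) (respStep (d := 3) (Lc ^ i) (Lc ^ k))
          (unitS (sfStep Lc i) (smStep 3 Lc i) (freshAt Lc (toSite rr) 0 cΛ i)) κ' u') C δ)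
    (hC : ∃ C δ : ℝ, 0 < δ ∧ ∀ (rr : Fin (3 + 1) → ℕ), rr ∈ box (3 + 1) Lc → ∀ k : ℕ,
      LocStencil (∑ i ∈ Finset.range k, fun κ' u' => (cE * (Lc : ℝ) ^ (2 * (3 + 1))) ^ (k - i) •
        (push₃ (legChain (respStepBmSeq (toSite rr) Lc) i (k - 1 - i)) (legChain (respStepBmSeq (toSite rr) Lc) i (k - 1 - i))
            (legChain (respStepBmSeq (toSite rr) Lc) i (k - 1 - i)) (unitS (sfStep Lc i) (smStep 3 Lc i) (freshAt Lc (toSite rr) 0 cΛ i)) κ' u'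
          - push₃ (respStep (d := 3) (Lc ^ i) (Lc ^ k)) (respStep (d := 3) (Lc ^ i) (Lc ^ k)) (respStep (d := 3) (Lc ^ i) (Lc ^ k))
            (unitS (sfStep Lc i) (smStep 3 Lc i) (freshAt Lc (toSite rr) 0 cΛ i)) κ' u')) C δ) :
    ∃ C δ : ℝ, 0 < δ ∧ ∀ (rr : Fin (3 + 1) → ℕ), rr ∈ box (3 + 1) Lc →
      ∀ k : ℕ, LocStencil (unitS (sfStep Lc k) (smStep 3 Lc k) (bornSecAt Lc (toSite rr) cE 0 cΛ k)) C δ :=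
  exists_hBLam_of_letters (d := 3) cE cΛ (exists_hX_lam_three cΛ) hU hC

end Summit.QuantumFields.BalabanUV.Beta.GAN24.BornLambdaLineage

end
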